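/-
Copyright (c) 2026. All rights reserved.
Released under Apache 2.0 license as described in the file LICENSE.
-/
import Summits.HodgeConjecture.HodgeConjecture.Theorems.K2E1SphericalEisensteinMeromorphicExportsU2Global   -- ★ X2 core (this seat): `sphericalEisenstein_meromorphic_exports_core_cm_two`
import Summits.HodgeConjecture.HodgeConjecture.Theorems.K2E1BLEvaluationFunctionalUniformU2             -- ★ P3-D uniform `exists_bound_evalCLM_of_isCompact`
import Summits.HodgeConjecture.HodgeConjecture.Theorems.K2E1BLHeckeOperatorWeightedU2                   -- ★ FILE A `exists_ciSup_borelHeight_mul_le_of_isCompact` (height distortion on compacta)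
import HarnessLib

/-!
# «CLOSER₂ EXPORTS», FILE X2b — `K2E1SphericalEisensteinMeromorphicExportsU2Bounds`: THE export head of `U(1,1)_{L∕L⁺}` with the locally uniform bound (E2)

Track B ∕ K2-LIT, crux h413 = `stmt-HodgeConjecture-24833`, route of record `HCCMUnconditional`; cell `hodgecm-mathlib`, squad K2, ENGINE E1.  THEOREMS ONLY (no `def`, no `instance`,
no `notation`, no `sorry`; default heartbeats); lane `--supports stmt-HodgeConjecture-24833 --as helper` (count-neutral).
WHAT.  ★ FILE X2 `sphericalEisenstein_meromorphic_exports_core_cm_two` plus the clause (E2): for every `z₀ ∉ P` and every compact `K ⊆ G(𝔸)` there are a neighbourhood `V` of `z₀`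
and `M` with `‖Ec z g‖ ≤ M` for all `z ∈ V`, `g ∈ K`.  At a GODEMENT point (`1 < Re z₀`): `Ec z = E(φ₀H^z)` on the ball of radius `(Re z₀ − 1)∕2`, ★ uniform majorant
`norm_eisensteinSeriesU_flatSectionU_le_uniform_cm_two` (`‖E_z(g)‖ ≤ ‖φ₀‖·C·(⨆_γ H(γg))^{σ₂}` on vertical strips) and ★ height distortion on compacta
`exists_ciSup_borelHeight_mul_le_of_isCompact` (`⨆_γ H(γg) ≤ κ'·⨆_γ H(γ)` for `g ∈ K`).  At a point of the holomorphy set `U m` (`m = ⌈‖z₀‖⌉₊`): a closed ball `V ⊆ U m ∩ Pᶜ ∩ {ĥ_j ≠ 0}`,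
(E5) `Ec z g = ĥ_j(z)⁻¹·∫ h_j·vX(z)[(g ·)⁻¹] = Λ_{g,j}(ĥ_j(z)⁻¹•vX(z))` with the ★ UNIFORM P3-D functionals `‖Λ_{g,j}‖ ≤ C₀` over `K` (`exists_bound_evalCLM_of_isCompact`), and the bound of
the continuous `z ↦ ĥ_j(z)⁻¹•vX(z)` on the compact `V`.
* §1 HEAD **`sphericalEisenstein_meromorphic_exports_cm_two`** = ★ X2 core ∧ (E2) (clause order: (E1), (E4), (E2), (E3), per-ball package with (E5)).
HONEST LABEL: HC_CM is proved only modulo the 7 printed citations (2 remaining named inputs: hLiu418 = `stmt-HodgeConjecture-24832`, h413 = `stmt-HodgeConjecture-24833`) until rung 0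
closes; this file asserts no named fact, closes no socket; count-neutral; letter-free.
[cite: BernsteinLapid2019, Thm 2.3, §2.4 and §4 Claims 1–5 (pp. 9–10)] [cite: MoeglinWaldspurger1995, II.1.5, IV.1.8–IV.1.10] [cite: Langlands1976, §7]

## References
* [BernsteinLapid2019] J. Bernstein, E. Lapid, *On the meromorphic continuation of Eisenstein series*, J. AMS 37 (2024), Thm 2.3, §2, §4.
* [MoeglinWaldspurger1995] C. Mœglin, J.-L. Waldspurger, *Spectral decomposition and Eisenstein series* (1995), II.1.5, IV.1.8–IV.1.10.
* [Langlands1976] R. P. Langlands, *On the Functional Equations Satisfied by Eisenstein Series*, LNM 544 (1976), §7.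
-/

set_option autoImplicit false
set_option linter.dupNamespace false  -- the mandated namespace repeats the summit's segment (`HodgeConjecture.HodgeConjecture`)

noncomputable section

open MeasureTheory Filter Topology Set NumberField
open scoped NNReal ENNReal Classical ComplexConjugate
open Literature.MeasureTheory.Group Literature.NumberTheory Literature.NumberTheory.Automorphic Literature.NumberTheory.Automorphic.UnitaryGroup AdelicGroupData
open Summit.HodgeConjecture.HodgeConjecture.Cruxes.H413.K2E1BorelEisensteinU
open Summit.HodgeConjecture.HodgeConjecture.Cruxes.H413.K2E1BLBorelSpacesU2Defs
open Summit.HodgeConjecture.HodgeConjecture.Cruxes.H413.K2E1BLBorelOperatorsU2Defs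
open Summit.HodgeConjecture.HodgeConjecture.Cruxes.H413.K2E1BLEvaluationFunctionalUniformU2 (exists_bound_evalCLM_of_isCompact)
open Summit.HodgeConjecture.HodgeConjecture.Cruxes.H413.K2E1BLHeckeOperatorWeightedU2 (exists_ciSup_borelHeight_mul_le_of_isCompact)
open Summit.HodgeConjecture.HodgeConjecture.Cruxes.H413.K2E1BLEisensteinMemHXCMTwo (norm_eisensteinSeriesU_flatSectionU_le_uniform_cm_two)
open Summit.HodgeConjecture.HodgeConjecture.Cruxes.H413.K2E1BLLiftIntegrabilityU (quotFun_lift lift_quotientSubgroup_mul)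
open Summit.HodgeConjecture.HodgeConjecture.Cruxes.H413.K2E1SphericalHeckeEigenSectionU2 (differentiable_integral_mul_borelHeight_cpow)
open Summit.HodgeConjecture.HodgeConjecture.Cruxes.H413.K2E1SphericalEisensteinMeromorphicExportsU2Global (sphericalEisenstein_meromorphic_exports_core_cm_two)

namespace Summit.HodgeConjecture.HodgeConjecture.Cruxes.H413.K2E1SphericalEisensteinMeromorphicExportsU2Bounds

variable (L : Type) [Field L] [NumberField L] [IsCMField L]
  [MeasurableSpace (quasiSplit (↥(maximalRealSubfield L)) L (IsCMField.complexConj L) 2).Adelic] [BorelSpace (quasiSplit (↥(maximalRealSubfield L)) L (IsCMField.complexConj L) 2).Adelic]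

/-- **HEAD — THE GLOBAL BERNSTEIN–LAPID EXPORTS OF `U(1,1)_{L∕L⁺}` WITH THE LOCALLY UNIFORM BOUND (E2)** (module docstring): ★ X2 core's conclusion with, after (E4), the clause
(E2) `∀ z₀ ∉ P, ∀ K compact, ∃ V ∈ 𝓝 z₀, ∃ M, ∀ z ∈ V, ∀ g ∈ K, ‖Ec z g‖ ≤ M` (Godement points: ★ uniform majorant + ★ height distortion on compacta; `U`-points: (E5) + ★ uniform
P3-D functionals + compactness). [cite: BernsteinLapid2019, Thm 2.3, §2.4 and §4 Claims 1–5 (pp. 9–10)] [cite: MoeglinWaldspurger1995, II.1.5, IV.1.8–IV.1.10] -/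
theorem sphericalEisenstein_meromorphic_exports_cm_two
    -- structural letters: the measures (verbatim as FILE X1 ∕ ★ closer₂)
    (μ : Measure (quasiSplit (↥(maximalRealSubfield L)) L (IsCMField.complexConj L) 2).automorphicQuotient) [(quasiSplit (↥(maximalRealSubfield L)) L (IsCMField.complexConj L) 2).IsAutomorphicMeasure μ]
    (νG : Measure (quasiSplit (↥(maximalRealSubfield L)) L (IsCMField.complexConj L) 2).Adelic) [νG.IsHaarMeasure] [νG.IsInvInvariant] [SFinite νG]
    (ν : Measure ↥(adelicUnipotent (↥(maximalRealSubfield L)) L (IsCMField.complexConj L) 2)) [ν.IsHaarMeasure] [ν.IsMulRightInvariant] [ν.IsInvInvariant]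
    {𝓕 : Set ↥(adelicUnipotent (↥(maximalRealSubfield L)) L (IsCMField.complexConj L) 2)}
    (h𝓕N : IsFundamentalDomain ↥(rationalUnipotent (↥(maximalRealSubfield L)) L (IsCMField.complexConj L) 2) 𝓕 ν) (h𝓕c : IsCompact (closure 𝓕)) (h𝓕₀ : ν 𝓕 ≠ 0)
    {β : (quasiSplit (↥(maximalRealSubfield L)) L (IsCMField.complexConj L) 2).Adelic → ℝ≥0∞}
    (hβ : IsCoveringWeight ↥((arithmeticBorel (↥(maximalRealSubfield L)) L (IsCMField.complexConj L) 2).map (quasiSplit (↥(maximalRealSubfield L)) L (IsCMField.complexConj L) 2).arithmeticSubgroup.subtype) β)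
    {μZ : Measure (borelQuotient (↥(maximalRealSubfield L)) L (IsCMField.complexConj L) 2)} [SFinite μZ]
    (hμZ : ∀ f : borelQuotient (↥(maximalRealSubfield L)) L (IsCMField.complexConj L) 2 → ℝ≥0∞, Measurable f → ∫⁻ z, f z ∂μZ = ∫⁻ g, β g * f (toBorelQuotient (↥(maximalRealSubfield L)) L (IsCMField.complexConj L) 2 g) ∂νG)
    (φ₀ : ℂ) :
    ∃ (Ec : ℂ → (quasiSplit (↥(maximalRealSubfield L)) L (IsCMField.complexConj L) 2).Adelic → ℂ) (P : Set ℂ) (cI : ℂ → ℂ)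
      (I : ℕ → Type) (_ : ∀ n, Fintype (I n)) (η : (n : ℕ) → I n → GL (Fin 2) (AdeleRing (𝓞 L) L) → ℝ) (h : (n : ℕ) → I n → (quasiSplit (↥(maximalRealSubfield L)) L (IsCMField.complexConj L) 2).Adelic → ℂ)
      (a : ℕ → ℝ≥0) (κ : (n : ℕ) → I n → ℝ≥0) (T : (n : ℕ) → I n → HX (↥(maximalRealSubfield L)) L (IsCMField.complexConj L) 2 (n + 3) μ →L[ℂ] HX (↥(maximalRealSubfield L)) L (IsCMField.complexConj L) 2 (n + 3) μ) (U : ℕ → Set ℂ)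
      (vX : (n : ℕ) → ℂ → HX (↥(maximalRealSubfield L)) L (IsCMField.complexConj L) 2 (n + 3) μ) (cc : ℕ → ℂ → ℂ),
      -- GLOBAL: normal-form meromorphy, the Godement agreement, the pole set `P` (closed, co-discrete, inside `{Re ≤ 1}`, off `P` one is in the holomorphy sets)
      (∀ g, MeromorphicNFOn (fun z => Ec z g) univ) ∧ (∀ z : ℂ, 1 < z.re → Ec z = eisensteinSeriesU (flatSectionU (fun _ : (quasiSplit (↥(maximalRealSubfield L)) L (IsCMField.complexConj L) 2).Adelic => φ₀) z)) ∧
      IsClosed P ∧ (∀ z₀ : ℂ, ∀ᶠ s in 𝓝[≠] z₀, s ∉ P) ∧ (∀ z ∈ P, z.re ≤ 1) ∧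
      (∀ z : ℂ, z ∉ P → 1 < z.re ∨ (z ∈ U ⌈‖z‖⌉₊ ∧ z ∈ U (⌈‖z‖⌉₊ + 1))) ∧
      -- (E1) analytic off `P`; (E4) continuous in `g` off `P`; (E2) locally bounded near every `z₀ ∉ P`, uniformly on compacta in `g`
      (∀ g (z : ℂ), z ∉ P → AnalyticAt ℂ (fun z => Ec z g) z) ∧ (∀ z : ℂ, z ∉ P → Continuous (Ec z)) ∧
      (∀ z₀ : ℂ, z₀ ∉ P → ∀ K : Set (quasiSplit (↥(maximalRealSubfield L)) L (IsCMField.complexConj L) 2).Adelic, IsCompact K → ∃ V ∈ 𝓝 z₀, ∃ M : ℝ, ∀ z ∈ V, ∀ g ∈ K, ‖Ec z g‖ ≤ M) ∧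
      -- (E3) the constant-term coefficient `cI`: normal-form meromorphic on `ℂ`, analytic off `P`, `= c` on `{1 < Re}`, and the constant-term link there
      MeromorphicNFOn cI univ ∧ (∀ z : ℂ, z ∉ P → AnalyticAt ℂ cI z) ∧ (∀ z : ℂ, 1 < z.re → cI z = ((((ν 𝓕).toReal⁻¹ : ℝ)) : ℂ) * (∫ v : ↥(adelicUnipotent (↥(maximalRealSubfield L)) L (IsCMField.complexConj L) 2), (((borelHeight ((quasiSplit (↥(maximalRealSubfield L)) L (IsCMField.complexConj L) 2).toAdelic (weylLongU ((IsCMField.complexConj L : L ≃ₐ[↥(maximalRealSubfield L)] L) : L →+* L) (rfl : (StdForm.antidiagonal 2).over L = (StdForm.antidiagonal 2).over L)) * (v : (quasiSplit (↥(maximalRealSubfield L)) L (IsCMField.complexConj L) 2).Adelic)) : ℝ) : ℂ) ^ z) ∂ν)) ∧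
      (∀ z : ℂ, 1 < z.re → ∀ g : (quasiSplit (↥(maximalRealSubfield L)) L (IsCMField.complexConj L) 2).Adelic, borelConstantTerm ν 𝓕 (Ec z) g = φ₀ * (((borelHeight g : ℝ) : ℂ) ^ z + cI z * ((borelHeight g : ℝ) : ℂ) ^ (1 - z))) ∧
      -- PER BALL `D_n = ball 0 (n+2)` (weight `n + 3`): FILE X1's package ((R1), `h = S_η η`, regularity, cover, (R3), (R2), `U n`, `vX n`, `cc n`, Godement, eigen, `α`-system)
      -- and (E5) THE POINTWISE REPRESENTATION of the global `Ec` in X1's integral currency at every `z ∈ U n ∖ P` with `ĥ_j(z) ≠ 0`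
      ∀ n : ℕ,
        (∀ i, IsTestFunctionGL 2 L (η n i) ∧ (∀ g, 0 ≤ η n i g) ∧ (∀ g, η n i g⁻¹ = η n i g) ∧
          ∀ k₁ k₂ : (quasiSplit (↥(maximalRealSubfield L)) L (IsCMField.complexConj L) 2).Adelic, adelicVal (↥(maximalRealSubfield L)) L (IsCMField.complexConj L) 2 ((StdForm.antidiagonal 2).over L) k₁ ∈ standardMaximalCompactGL 2 L → adelicVal (↥(maximalRealSubfield L)) L (IsCMField.complexConj L) 2 ((StdForm.antidiagonal 2).over L) k₂ ∈ standardMaximalCompactGL 2 L →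
              ∀ x, η n i (adelicVal (↥(maximalRealSubfield L)) L (IsCMField.complexConj L) 2 ((StdForm.antidiagonal 2).over L) (k₁ * x * k₂)) = η n i (adelicVal (↥(maximalRealSubfield L)) L (IsCMField.complexConj L) 2 ((StdForm.antidiagonal 2).over L) x)) ∧
        (∀ i, h n i = fun y : (quasiSplit (↥(maximalRealSubfield L)) L (IsCMField.complexConj L) 2).Adelic => orbitalSmoothing νG (fun x : (quasiSplit (↥(maximalRealSubfield L)) L (IsCMField.complexConj L) 2).Adelic => ((η n i (adelicVal (↥(maximalRealSubfield L)) L (IsCMField.complexConj L) 2 ((StdForm.antidiagonal 2).over L) x) : ℝ) : ℂ)) (fun x : (quasiSplit (↥(maximalRealSubfield L)) L (IsCMField.complexConj L) 2).Adelic => ((η n i (adelicVal (↥(maximalRealSubfield L)) L (IsCMField.complexConj L) 2 ((StdForm.antidiagonal 2).over L) x) : ℝ) : ℂ)) y) ∧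
        (∀ i, Continuous (h n i) ∧ HasCompactSupport (h n i) ∧
          (∀ k₀ : (quasiSplit (↥(maximalRealSubfield L)) L (IsCMField.complexConj L) 2).Adelic, adelicVal (↥(maximalRealSubfield L)) L (IsCMField.complexConj L) 2 ((StdForm.antidiagonal 2).over L) k₀ ∈ standardMaximalCompactGL 2 L → ∀ x, h n i (k₀ * x) = h n i x) ∧
          (∀ g, h n i g⁻¹ = h n i g) ∧ (∀ g, conj (h n i g) = h n i g) ∧ (∀ g, 0 ≤ (h n i g).re)) ∧
        (∀ z ∈ Metric.ball (0 : ℂ) (n + 2), ∃ i, (∫ x, h n i x * (((borelHeight x : ℝ≥0) : ℝ) : ℂ) ^ z ∂νG) ≠ 0) ∧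
        0 < a n ∧ (∀ i, 1 ≤ κ n i) ∧
        (∀ i, ∀ z : borelQuotient (↥(maximalRealSubfield L)) L (IsCMField.complexConj L) 2, ∀ y ∈ tsupport (h n i), borelQuotHeight (↥(maximalRealSubfield L)) L (IsCMField.complexConj L) 2 z ≤ κ n i * borelQuotHeight (↥(maximalRealSubfield L)) L (IsCMField.complexConj L) 2 (rightShift (↥(maximalRealSubfield L)) L (IsCMField.complexConj L) 2 y z)) ∧
        (∀ i, ∀ u : HX (↥(maximalRealSubfield L)) L (IsCMField.complexConj L) 2 (n + 3) μ, (T n i u : (quasiSplit (↥(maximalRealSubfield L)) L (IsCMField.complexConj L) 2).automorphicQuotient → ℂ) =ᵐ[(μ.withDensity fun x => (((supHeight (↥(maximalRealSubfield L)) L (IsCMField.complexConj L) 2 x)⁻¹ ^ (2 * (n + 3)) : ℝ≥0) : ℝ≥0∞))]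
            fun ξ => ∫ y, h n i y * (u : (quasiSplit (↥(maximalRealSubfield L)) L (IsCMField.complexConj L) 2).automorphicQuotient → ℂ) (y⁻¹ • ξ) ∂νG) ∧
        IsOpen (U n) ∧ U n ⊆ Metric.ball (0 : ℂ) (n + 2) ∧ Metric.ball (0 : ℂ) (n + 2) ⊆ closure (U n) ∧ (∀ z₀ ∈ Metric.ball (0 : ℂ) (n + 2), ∀ᶠ s in 𝓝[≠] z₀, s ∈ U n) ∧
        DifferentiableOn ℂ (vX n) (U n) ∧ MeromorphicOn (vX n) (Metric.ball (0 : ℂ) (n + 2)) ∧ DifferentiableOn ℂ (cc n) (U n) ∧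
        (∀ z ∈ U n, 1 < z.re → ((vX n z : HX (↥(maximalRealSubfield L)) L (IsCMField.complexConj L) 2 (n + 3) μ) : (quasiSplit (↥(maximalRealSubfield L)) L (IsCMField.complexConj L) 2).automorphicQuotient → ℂ) =ᵐ[(μ.withDensity fun x => (((supHeight (↥(maximalRealSubfield L)) L (IsCMField.complexConj L) 2 x)⁻¹ ^ (2 * (n + 3)) : ℝ≥0) : ℝ≥0∞))] (quasiSplit (↥(maximalRealSubfield L)) L (IsCMField.complexConj L) 2).quotFun (eisensteinSeriesU (flatSectionU (fun _ : (quasiSplit (↥(maximalRealSubfield L)) L (IsCMField.complexConj L) 2).Adelic => φ₀) z))) ∧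
        (∀ z ∈ U n, ∀ i, T n i (vX n z) = (∫ x, h n i x * (((borelHeight x : ℝ≥0) : ℝ) : ℂ) ^ z ∂νG) • vX n z) ∧
        (∃ (hb : IotaBound (↥(maximalRealSubfield L)) L (IsCMField.complexConj L) 2 (n + 3) (a n) μ μZ) (α₁ α₂ : ℂ → HN (↥(maximalRealSubfield L)) L (IsCMField.complexConj L) 2 (n + 3) (a n) μZ),
          (∀ z ∈ Metric.ball (0 : ℂ) (n + 2), (α₁ z : borelQuotient (↥(maximalRealSubfield L)) L (IsCMField.complexConj L) 2 → ℂ) =ᵐ[weightedTruncMeasure (↥(maximalRealSubfield L)) L (IsCMField.complexConj L) 2 (n + 3) (a n) μZ] fun x => (((borelQuotHeight (↥(maximalRealSubfield L)) L (IsCMField.complexConj L) 2 x : ℝ≥0) : ℝ) : ℂ) ^ z) ∧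
          (∀ z ∈ Metric.ball (0 : ℂ) (n + 2), (α₂ z : borelQuotient (↥(maximalRealSubfield L)) L (IsCMField.complexConj L) 2 → ℂ) =ᵐ[weightedTruncMeasure (↥(maximalRealSubfield L)) L (IsCMField.complexConj L) 2 (n + 3) (a n) μZ] fun x => (((borelQuotHeight (↥(maximalRealSubfield L)) L (IsCMField.complexConj L) 2 x : ℝ≥0) : ℝ) : ℂ) ^ (1 - z)) ∧
          (∀ z ∈ Metric.ball (0 : ℂ) (n + 2), α₂ z ≠ 0) ∧
          ∀ z ∈ U n, cnstN (↥(maximalRealSubfield L)) L (IsCMField.complexConj L) 2 (n + 3) (a n) μZ (iota hb (vX n z)) = φ₀ • α₁ z + cc n z • α₂ z) ∧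
        (∀ j, ∀ z ∈ U n, z ∉ P → (∫ x, h n j x * (((borelHeight x : ℝ≥0) : ℝ) : ℂ) ^ z ∂νG) ≠ 0 →
          ∀ g : (quasiSplit (↥(maximalRealSubfield L)) L (IsCMField.complexConj L) 2).Adelic, Ec z g = (∫ x, h n j x * (((borelHeight x : ℝ≥0) : ℝ) : ℂ) ^ z ∂νG)⁻¹ * ∫ y, h n j y * ((vX n z : HX (↥(maximalRealSubfield L)) L (IsCMField.complexConj L) 2 (n + 3) μ) : (quasiSplit (↥(maximalRealSubfield L)) L (IsCMField.complexConj L) 2).automorphicQuotient → ℂ) ((quasiSplit (↥(maximalRealSubfield L)) L (IsCMField.complexConj L) 2).toAutomorphicQuotient (g * y)⁻¹) ∂νG) := by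
  -- the core package (★ FILE X2)
  obtain ⟨Ec, P, cI, I, hI, η, h, a, κ, T, U, vX, cc, hNF, hEcE, hPc, hPcd, hPre, hPU, hE1, hE4, hcNF, hcan, hcc, hE3, hballs⟩ :=
    sphericalEisenstein_meromorphic_exports_core_cm_two L μ νG ν h𝓕N h𝓕c h𝓕₀ hβ hμZ φ₀
  refine ⟨Ec, P, cI, I, hI, η, h, a, κ, T, U, vX, cc, hNF, hEcE, hPc, hPcd, hPre, hPU, hE1, hE4, fun z₀ hz₀ K hK => ?_, hcNF, hcan, hcc, hE3, hballs⟩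
  -- a non-zero trace-zero element of `L` (for the uniform Godement bound)
  have hc1 : IsCMField.complexConj L ≠ 1 := IsCMField.complexConj_ne_one L
  obtain ⟨δ, hcδ, hδ⟩ : ∃ δ : L, IsCMField.complexConj L δ = -δ ∧ δ ≠ 0 := by
    obtain ⟨e, he⟩ : ∃ e : L, IsCMField.complexConj L e ≠ e := by
      by_contra hne
      exact hc1 (AlgEquiv.ext fun x => not_ne_iff.mp (not_exists.mp hne x))
    exact ⟨e - IsCMField.complexConj L e, by rw [map_sub, IsCMField.complexConj_apply_apply, neg_sub], sub_ne_zero.2 (Ne.symm he)⟩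
  rcases hPU z₀ hz₀ with hz1 | ⟨hzU, -⟩
  · -- a GODEMENT point: `Ec z = E(φ₀H^z)` on the ball of radius `(Re z₀ − 1)∕2`, ★ uniform majorant + ★ height distortion on the compact `K`
    obtain ⟨C, hC0, hC⟩ := norm_eisensteinSeriesU_flatSectionU_le_uniform_cm_two L hcδ hδ ν h𝓕N h𝓕c φ₀ (σ₁ := (z₀.re + 1) / 2) (σ₂ := z₀.re + (z₀.re - 1) / 2) (by linarith)
    obtain ⟨κ', -, hκ'⟩ := exists_ciSup_borelHeight_mul_le_of_isCompact hK
    refine ⟨Metric.ball z₀ ((z₀.re - 1) / 2), Metric.ball_mem_nhds z₀ (by linarith), ‖φ₀‖ * C * (((κ' * (⨆ γ : (quasiSplit (↥(maximalRealSubfield L)) L (IsCMField.complexConj L) 2).arithmeticSubgroup, borelHeight ((γ : (quasiSplit (↥(maximalRealSubfield L)) L (IsCMField.complexConj L) 2).Adelic) * 1)) : ℝ≥0)) : ℝ) ^ (z₀.re + (z₀.re - 1) / 2),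
      fun z hz g hg => ?_⟩
    have hzre : |z.re - z₀.re| < (z₀.re - 1) / 2 := by
      have h1 := Complex.abs_re_le_norm (z - z₀)
      rw [Complex.sub_re] at h1
      exact h1.trans_lt (mem_ball_iff_norm.1 hz)
    rw [hEcE z (by linarith [(abs_lt.1 hzre).1])]
    refine (hC z (by linarith [(abs_lt.1 hzre).1]) (by linarith [(abs_lt.1 hzre).2]) g).trans ?_
    have hsup := (hκ' 1 g hg).1
    simp only [one_mul] at hsup
    exact mul_le_mul_of_nonneg_left (Real.rpow_le_rpow (NNReal.coe_nonneg _) (NNReal.coe_le_coe.2 hsup) (by linarith)) (mul_nonneg (norm_nonneg _) hC0)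
  · -- a point of the holomorphy set `U m`, `m = ⌈‖z₀‖⌉₊`: (E5) + ★ uniform P3-D functionals over `K` + compactness of a closed ball inside `U m ∩ Pᶜ ∩ {ĥ_j ≠ 0}`
    obtain ⟨-, -, hreg, hcov, -, -, -, -, hUo, hUD, -, -, hvXd, -, -, -, -, -, hE5⟩ := hballs ⌈‖z₀‖⌉₊
    obtain ⟨j, hj⟩ := hcov z₀ (by rw [Metric.mem_ball, dist_zero_right]; linarith [Nat.le_ceil ‖z₀‖])
    have hĥc : Continuous fun s : ℂ => (∫ x, h ⌈‖z₀‖⌉₊ j x * (((borelHeight x : ℝ≥0) : ℝ) : ℂ) ^ s ∂νG) :=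
      (differentiable_integral_mul_borelHeight_cpow νG (hreg j).1 (hreg j).2.1).continuous
    have hO : IsOpen (U ⌈‖z₀‖⌉₊ ∩ Pᶜ ∩ {s : ℂ | (∫ x, h ⌈‖z₀‖⌉₊ j x * (((borelHeight x : ℝ≥0) : ℝ) : ℂ) ^ s ∂νG) ≠ 0}) := (hUo.inter hPc.isOpen_compl).inter (isOpen_compl_singleton.preimage hĥc)
    obtain ⟨r, hr0, hrO⟩ := Metric.nhds_basis_closedBall.mem_iff.1 (hO.mem_nhds ⟨⟨hzU, hz₀⟩, hj⟩)
    obtain ⟨C₀, hC₀⟩ := exists_bound_evalCLM_of_isCompact μ νG (⌈‖z₀‖⌉₊ + 3) (h := fun x => (h ⌈‖z₀‖⌉₊ j x).re) (Complex.continuous_re.comp (hreg j).1) ((hreg j).2.1.comp_left Complex.zero_re) hK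
    have hcont : ContinuousOn (fun s : ℂ => (∫ x, h ⌈‖z₀‖⌉₊ j x * (((borelHeight x : ℝ≥0) : ℝ) : ℂ) ^ s ∂νG)⁻¹ • vX ⌈‖z₀‖⌉₊ s) (Metric.closedBall z₀ r) :=
      (hĥc.continuousOn.inv₀ fun s hs => (hrO hs).2).smul (hvXd.continuousOn.mono fun s hs => (hrO hs).1.1)
    obtain ⟨C, hC⟩ := (isCompact_closedBall z₀ r).exists_bound_of_continuousOn hcont
    refine ⟨Metric.closedBall z₀ r, Metric.closedBall_mem_nhds z₀ hr0, C₀ * C, fun z hz g hg => ?_⟩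
    obtain ⟨Λ, hΛn, hΛ⟩ := hC₀ g hg
    have hre : ∀ x, ((((h ⌈‖z₀‖⌉₊ j x).re : ℝ)) : ℂ) = h ⌈‖z₀‖⌉₊ j x := fun x => Complex.conj_eq_iff_re.1 ((hreg j).2.2.2.2.1 x)
    have hΛv : Λ (vX ⌈‖z₀‖⌉₊ z) = ∫ y, h ⌈‖z₀‖⌉₊ j y * ((vX ⌈‖z₀‖⌉₊ z : HX (↥(maximalRealSubfield L)) L (IsCMField.complexConj L) 2 (⌈‖z₀‖⌉₊ + 3) μ) : (quasiSplit (↥(maximalRealSubfield L)) L (IsCMField.complexConj L) 2).automorphicQuotient → ℂ) ((quasiSplit (↥(maximalRealSubfield L)) L (IsCMField.complexConj L) 2).toAutomorphicQuotient (g * y)⁻¹) ∂νG := by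
      have hmem : MemLp ((quasiSplit (↥(maximalRealSubfield L)) L (IsCMField.complexConj L) 2).quotFun (fun y : (quasiSplit (↥(maximalRealSubfield L)) L (IsCMField.complexConj L) 2).Adelic => ((vX ⌈‖z₀‖⌉₊ z : HX (↥(maximalRealSubfield L)) L (IsCMField.complexConj L) 2 (⌈‖z₀‖⌉₊ + 3) μ) : (quasiSplit (↥(maximalRealSubfield L)) L (IsCMField.complexConj L) 2).automorphicQuotient → ℂ) ((quasiSplit (↥(maximalRealSubfield L)) L (IsCMField.complexConj L) 2).toAutomorphicQuotient y⁻¹))) 2 (μ.withDensity fun x => (((supHeight (↥(maximalRealSubfield L)) L (IsCMField.complexConj L) 2 x)⁻¹ ^ (2 * (⌈‖z₀‖⌉₊ + 3)) : ℝ≥0) : ℝ≥0∞)) := by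
        rw [quotFun_lift]; exact Lp.memLp (vX ⌈‖z₀‖⌉₊ z)
      have htoHX : toHX (↥(maximalRealSubfield L)) L (IsCMField.complexConj L) 2 (⌈‖z₀‖⌉₊ + 3) μ (fun y : (quasiSplit (↥(maximalRealSubfield L)) L (IsCMField.complexConj L) 2).Adelic => ((vX ⌈‖z₀‖⌉₊ z : HX (↥(maximalRealSubfield L)) L (IsCMField.complexConj L) 2 (⌈‖z₀‖⌉₊ + 3) μ) : (quasiSplit (↥(maximalRealSubfield L)) L (IsCMField.complexConj L) 2).automorphicQuotient → ℂ) ((quasiSplit (↥(maximalRealSubfield L)) L (IsCMField.complexConj L) 2).toAutomorphicQuotient y⁻¹)) hmem = vX ⌈‖z₀‖⌉₊ z := by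
        have key : ∀ (f : (quasiSplit (↥(maximalRealSubfield L)) L (IsCMField.complexConj L) 2).automorphicQuotient → ℂ) (hf : MemLp f 2 (μ.withDensity fun x => (((supHeight (↥(maximalRealSubfield L)) L (IsCMField.complexConj L) 2 x)⁻¹ ^ (2 * (⌈‖z₀‖⌉₊ + 3)) : ℝ≥0) : ℝ≥0∞))), f = ((vX ⌈‖z₀‖⌉₊ z : HX (↥(maximalRealSubfield L)) L (IsCMField.complexConj L) 2 (⌈‖z₀‖⌉₊ + 3) μ) : (quasiSplit (↥(maximalRealSubfield L)) L (IsCMField.complexConj L) 2).automorphicQuotient → ℂ) → hf.toLp f = vX ⌈‖z₀‖⌉₊ z := by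
          rintro f hf rfl; exact Lp.toLp_coeFn _ _
        exact key _ hmem (quotFun_lift _)
      have e := (hΛ (fun y : (quasiSplit (↥(maximalRealSubfield L)) L (IsCMField.complexConj L) 2).Adelic => ((vX ⌈‖z₀‖⌉₊ z : HX (↥(maximalRealSubfield L)) L (IsCMField.complexConj L) 2 (⌈‖z₀‖⌉₊ + 3) μ) : (quasiSplit (↥(maximalRealSubfield L)) L (IsCMField.complexConj L) 2).automorphicQuotient → ℂ) ((quasiSplit (↥(maximalRealSubfield L)) L (IsCMField.complexConj L) 2).toAutomorphicQuotient y⁻¹)) (lift_quotientSubgroup_mul _) hmem).2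
      rw [htoHX] at e
      rw [e]; simp only [hre]
    have hsm : (∫ x, h ⌈‖z₀‖⌉₊ j x * (((borelHeight x : ℝ≥0) : ℝ) : ℂ) ^ z ∂νG)⁻¹ * Λ (vX ⌈‖z₀‖⌉₊ z) = Λ ((∫ x, h ⌈‖z₀‖⌉₊ j x * (((borelHeight x : ℝ≥0) : ℝ) : ℂ) ^ z ∂νG)⁻¹ • vX ⌈‖z₀‖⌉₊ z) := by rw [map_smul, smul_eq_mul]
    rw [hE5 j z (hrO hz).1.1 (hrO hz).1.2 (hrO hz).2 g, ← hΛv, hsm]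
    exact (Λ.le_opNorm _).trans (mul_le_mul hΛn (hC z hz) (norm_nonneg _) ((norm_nonneg _).trans hΛn))

end Summit.HodgeConjecture.HodgeConjecture.Cruxes.H413.K2E1SphericalEisensteinMeromorphicExportsU2Bounds

end
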